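import Mathlib
import HarnessLib
import Literature.Analysis.FluidPDE.SuitableWeak
import Literature.Analysis.FluidPDE.SelfSimilar
import Literature.Analysis.FluidPDE.LocalTypeI
import Literature.Analysis.FluidPDE.SpaceTimeRescaling
import Literature.Analysis.FluidPDE.LocalTypeICongr
import Literature.Analysis.FluidPDE.TypeIRateOseenMildRepresentative
import Summits.NavierStokesRegularity.NavierStokesRegularity.Theorems.RellichScarApexLocalisationMildEquivalence
import Summits.NavierStokesRegularity.NavierStokesRegularity.Theses.RellichScar

/-!
# Line `decaying-ancient-bridge` (v3): the bet `stub_sparseSelection` is no stronger than the crux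

Crux `Summit.NavierStokesRegularity.NavierStokesRegularity.Theses.RellichScar.ApexLocalisation`
(stmt-NavierStokesRegularity-11719), skeleton v3 (`Cruxes/ApexLocalisation/Lines/decaying_ancient_bridge.lean`).
The registered bet `stub_sparseSelection` promises, from the crux antecedent, a CONTINUOUS singular
rate-Type-I class profile none of whose shell-centred Navier–Stokes images
`λ_k u(λ_k² t, x_k + λ_k x)` (`λ_k ≤ ‖x_k‖ ≤ 2λ_k`) converge in `L³(Q(0,R))` to an origin-singular
profile. This file certifies the converse direction of the equivalence "bet ⇔ crux (given the
known stubs)": an APEX profile (the crux's consequent) already has this property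
(`sparse_of_apexProfile`), hence `RellichScar.ApexLocalisation` implies the bet's conclusion
outright (`sparseSelection_of_apexLocalisation`) — the bet is exactly as strong as the crux.

Mechanism: the continuous Oseen-mild representative of an apex profile (tree
`exists_oseenMild_repr_of_typeIBound_lt_top`, majorant inherited everywhere by
`norm_le_of_ae_of_continuousOn`) obeys `‖u(t,x)‖ ≤ C/(‖x‖ + √(−t))` pointwise; a shell-centred image
then obeys `‖w_k(t,x)‖ ≤ C/(‖x_k/λ_k + x‖ + √(−t)) ≤ 2C` on `‖x‖ < 1/2` since `‖x_k/λ_k‖ ≥ 1`; an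
`L³(Q(0,1/2))`-limit inherits `‖v‖ ≤ 2C` a.e. there (convergence in measure, a.e. along a
subsequence), so the origin is not a backward singular point of `v`.
-/

-- the summit and its single sub-problem share the name (CONVENTIONS §1), as in every Theorems file
set_option linter.dupNamespace false

namespace Summit.NavierStokesRegularity.NavierStokesRegularity.Theorems.RellichScarApexLocalisation

open MeasureTheory Set Function Metric Filter Topology TopologicalSpace
open scoped ENNReal NNReal
open Literature.Analysis Literature.Analysis.FluidPDE
open Summit.NavierStokesRegularity.NavierStokesRegularity.Theses

local notation "E³" => EuclideanSpace ℝ (Fin 3)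

/-! ### An a.e. bound passes to `L³`-limits -/

/-- If `f_k → g` in `L³(μ)` and `‖f_k‖ ≤ B` pointwise (all `k`), then `‖g‖ ≤ B` `μ`-a.e.
(convergence in measure, a.e. convergence along a subsequence). -/
theorem ae_norm_le_of_tendsto_eLpNorm_three {α F : Type*} [MeasurableSpace α] [NormedAddCommGroup F]
    {μ : Measure α} {f : ℕ → α → F} {g : α → F} {B : ℝ}
    (hf : ∀ k, AEStronglyMeasurable (f k) μ) (hg : AEStronglyMeasurable g μ)
    (hB : ∀ k x, ‖f k x‖ ≤ B)
    (h : Tendsto (fun k => eLpNorm (f k - g) 3 μ) atTop (𝓝 0)) :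
    ∀ᵐ x ∂μ, ‖g x‖ ≤ B := by
  have h3 : (3 : ℝ≥0∞) ≠ 0 := by norm_num
  have hm : TendstoInMeasure μ f atTop g :=
    tendstoInMeasure_of_tendsto_eLpNorm (p := 3) h3 hf hg h
  obtain ⟨ns, -, hae⟩ := hm.exists_seq_tendsto_ae
  filter_upwards [hae] with x hx
  exact le_of_tendsto' (hx.norm) fun i => hB (ns i) x

/-! ### Shell-centred images of an apex profile are bounded near the origin -/

/-- For an apex field `‖u(t,y)‖ ≤ C/(‖y‖ + √(−t))` and a shell-centred image
`w(t,x) = λ u(λ² t, x₀ + λ x)` with `0 < λ ≤ ‖x₀‖`: `‖w(t,x)‖ ≤ 2C` whenever `t < 0`, `‖x‖ ≤ 1/2`. -/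
theorem norm_image_le_of_apex {C : ℝ} {u : ℝ → E³ → E³} (h : HasTypeIDecay C u)
    {lam : ℝ} (hlam : 0 < lam) {x₀ : E³} (hx₀ : lam ≤ ‖x₀‖) {t : ℝ} (ht : t < 0) {x : E³}
    (hx : ‖x‖ ≤ 1 / 2) :
    ‖(lam • stPull (lam ^ 2) lam 0 x₀ u) t x‖ ≤ 2 * C := by
  have hC : 0 ≤ C := nonneg_of_hasTypeIDecay h
  have hlt : lam ^ 2 * t < 0 := mul_neg_of_pos_of_neg (by positivity) ht
  have key := h (lam ^ 2 * t) hlt (x₀ + lam • x)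
  rw [smul_stPull_apply, zero_add, norm_smul, Real.norm_of_nonneg hlam.le]
  -- ‖x₀ + λ x‖ ≥ ‖x₀‖ - λ‖x‖ ≥ λ - λ/2 = λ/2
  have hnorm : lam / 2 ≤ ‖x₀ + lam • x‖ := by
    have h1 : ‖x₀‖ - ‖lam • x‖ ≤ ‖x₀ + lam • x‖ := by
      have := norm_sub_norm_le x₀ (-(lam • x))
      rw [norm_neg, sub_neg_eq_add] at this
      exact this
    have h2 : ‖lam • x‖ ≤ lam / 2 := by
      rw [norm_smul, Real.norm_of_nonneg hlam.le]
      nlinarith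
    linarith
  have hden : 0 < ‖x₀ + lam • x‖ + Real.sqrt (-(lam ^ 2 * t)) := by
    have : 0 ≤ Real.sqrt (-(lam ^ 2 * t)) := Real.sqrt_nonneg _
    linarith
  have h3 : ‖u (lam ^ 2 * t) (x₀ + lam • x)‖ ≤ C / (lam / 2) := by
    refine key.trans (div_le_div_of_nonneg_left hC (by positivity) ?_)
    have : 0 ≤ Real.sqrt (-(lam ^ 2 * t)) := Real.sqrt_nonneg _
    linarith
  calc lam * ‖u (lam ^ 2 * t) (x₀ + lam • x)‖ ≤ lam * (C / (lam / 2)) :=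
        mul_le_mul_of_nonneg_left h3 hlam.le
    _ = 2 * C := by field_simp

/-- Images of a slab-continuous field are continuous on the slab (affine change of variables
preserving `t < 0` as `λ² t < 0`). -/
theorem continuousOn_image {u : ℝ → E³ → E³} (hcont : ContinuousOn (uncurry u) (Iio (0 : ℝ) ×ˢ univ))
    {lam : ℝ} (hlam : 0 < lam) (x₀ : E³) :
    ContinuousOn (uncurry (lam • stPull (lam ^ 2) lam 0 x₀ u)) (Iio (0 : ℝ) ×ˢ univ) := by
  have hφ : Continuous fun q : ℝ × E³ => (0 + lam ^ 2 * q.1, x₀ + lam • q.2) := by fun_prop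
  have hmaps : MapsTo (fun q : ℝ × E³ => (0 + lam ^ 2 * q.1, x₀ + lam • q.2))
      (Iio (0 : ℝ) ×ˢ univ) (Iio (0 : ℝ) ×ˢ univ) := by
    intro q hq
    refine ⟨?_, mem_univ _⟩
    have : q.1 < 0 := mem_Iio.1 hq.1
    show 0 + lam ^ 2 * q.1 < 0
    nlinarith [mul_neg_of_pos_of_neg (pow_pos hlam 2) this]
  have h1 : ContinuousOn (fun q : ℝ × E³ => uncurry u (0 + lam ^ 2 * q.1, x₀ + lam • q.2))
      (Iio (0 : ℝ) ×ˢ univ) := hcont.comp hφ.continuousOn hmaps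
  have h2 : uncurry (lam • stPull (lam ^ 2) lam 0 x₀ u) =
      fun q : ℝ × E³ => lam • uncurry u (0 + lam ^ 2 * q.1, x₀ + lam • q.2) := by
    funext q
    rfl
  rw [h2]
  exact h1.const_smul lam

/-- `Q(0, R)` lies in the open backward slab. -/
theorem parabolicCylinder_zero_subset_slab' (R : ℝ) :
    parabolicCylinder R (0 : ℝ × E³) ⊆ Iio (0 : ℝ) ×ˢ (univ : Set E³) := by
  intro w hw
  rw [mem_parabolicCylinder] at hw
  exact ⟨by simpa using hw.1.2, mem_univ _⟩

/-! ### An apex profile satisfies the bet's conclusion -/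

/-- **An apex profile is sparse**: if `(u,p,G)` is a suitable weak slab profile with weak gradient,
`𝐈 < ⊤`, the APEX bound `HasTypeIDecay C u` and a singular origin, then (passing to its continuous
Oseen-mild representative) it is a continuous rate-Type-I class profile, singular at the origin, NONE
of whose shell-centred images `λ_k u(λ_k² t, x_k + λ_k x)` (`0 < λ_k ≤ ‖x_k‖`) converge in
`L³(Q(0,R))` (even for the single radius `R = 1/2`) to a field singular at the origin — the conclusion
of `stub_sparseSelection`, with `C' = C`, `I' = 𝐈(u)`. -/
theorem sparse_of_apexProfile {C : ℝ} {u : ℝ → E³ → E³} {p : ℝ → E³ → ℝ}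
    {G : ℝ → E³ → E³ →L[ℝ] E³}
    (hsw : IsSuitableWeakSolutionOn (slab E³ (Iio 0) isOpen_Iio) 1 0 u p)
    (hwg : HasWeakSpatialGradientOn (slab E³ (Iio 0) isOpen_Iio) u G)
    (hI : typeIBound (Iio (0 : ℝ) ×ˢ univ) u p G < ⊤)
    (hdec : HasTypeIDecay C u) (hsing : IsBackwardSingularPoint u 0) :
    ∃ (C' : ℝ) (I' : ℝ≥0∞) (u : ℝ → E³ → E³) (p : ℝ → E³ → ℝ) (G : ℝ → E³ → E³ →L[ℝ] E³),
      I' < ⊤ ∧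
      IsSuitableWeakSolutionOn (slab E³ (Iio 0) isOpen_Iio) 1 0 u p ∧
      HasWeakSpatialGradientOn (slab E³ (Iio 0) isOpen_Iio) u G ∧
      typeIBound (Iio (0 : ℝ) ×ˢ univ) u p G ≤ I' ∧
      HasTypeITimeDecay C' u ∧
      ContinuousOn (uncurry u) (Iio (0 : ℝ) ×ˢ univ) ∧
      IsBackwardSingularPoint u 0 ∧
      ∀ (lk : ℕ → ℝ) (xk : ℕ → E³) (v : ℝ → E³ → E³) (q : ℝ → E³ → ℝ)
        (H : ℝ → E³ → E³ →L[ℝ] E³),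
        (∀ k, 0 < lk k ∧ lk k ≤ ‖xk k‖ ∧ ‖xk k‖ ≤ 2 * lk k) →
        IsSuitableWeakSolutionOn (slab E³ (Iio 0) isOpen_Iio) 1 0 v q →
        HasWeakSpatialGradientOn (slab E³ (Iio 0) isOpen_Iio) v H →
        typeIBound (Iio (0 : ℝ) ×ˢ univ) v q H ≤ 4 * I' →
        HasTypeITimeDecay C' v →
        ContinuousOn (uncurry v) (Iio (0 : ℝ) ×ˢ univ) →
        (∀ R : ℝ, 0 < R → Tendsto (fun k => eLpNorm
          (uncurry (lk k • stPull (lk k ^ 2) (lk k) 0 (xk k) u) - uncurry v) 3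
          (volume.restrict (parabolicCylinder R (0 : ℝ × E³)))) atTop (𝓝 0)) →
        ¬ IsBackwardSingularPoint v 0 := by
  have hC0 : 0 ≤ C := nonneg_of_hasTypeIDecay hdec
  -- ## the continuous Oseen-mild representative, with the apex majorant everywhere
  obtain ⟨v, hae, hvc, -, -, hvC⟩ :=
    exists_oseenMild_repr_of_typeIBound_lt_top hsw (hdec.hasTypeITimeDecay hC0) hI
  have hae' : ∀ᵐ w ∂(volume.restrict ((slab E³ (Iio 0) isOpen_Iio : Opens (ℝ × E³)) : Set (ℝ × E³))),
      uncurry u w = uncurry v w := by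
    rw [coe_slab]
    exact hae
  have hsw_v : IsSuitableWeakSolutionOn (slab E³ (Iio 0) isOpen_Iio) 1 0 v p :=
    hsw.congr_ae hae' (ae_of_all _ fun _ => rfl)
  have hwg_v : HasWeakSpatialGradientOn (slab E³ (Iio 0) isOpen_Iio) v G := hwg.congr_ae hae'
  have hI_v : typeIBound (Iio (0 : ℝ) ×ˢ univ) v p G < ⊤ := by
    rwa [← typeIBound_congr_ae hae]
  have hsing_v : IsBackwardSingularPoint v 0 :=
    hsing.congr_ae (fun r _ => parabolicCylinder_origin_subset_slab r) hae
  have hg : ContinuousOn (fun w : ℝ × E³ => C / (‖w.2‖ + Real.sqrt (-w.1))) (Iio (0 : ℝ) ×ˢ univ) := by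
    refine continuousOn_const.div (by fun_prop) fun w hw => ?_
    have : 0 < Real.sqrt (-w.1) := Real.sqrt_pos.2 (neg_pos.2 (mem_Iio.1 hw.1))
    positivity
  have hdec_v : HasTypeIDecay C v := by
    refine norm_le_of_ae_of_continuousOn hvc hg ?_
    have hall : ∀ᵐ w ∂(volume.restrict (Iio (0 : ℝ) ×ˢ (univ : Set E³))),
        w ∈ Iio (0 : ℝ) ×ˢ (univ : Set E³) :=
      ae_restrict_mem (isOpen_Iio.prod isOpen_univ).measurableSet
    filter_upwards [hae, hall] with w hw hwS
    rw [← hw]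
    exact hdec w.1 (mem_Iio.1 hwS.1) w.2
  -- ## the witness
  refine ⟨C, typeIBound (Iio (0 : ℝ) ×ˢ univ) v p G, v, p, G, hI_v, hsw_v, hwg_v, le_rfl, hvC, hvc,
    hsing_v, ?_⟩
  intro lk xk w q H hadm hw_sw _ _ _ _ hconv hwsing
  -- images are bounded by `2C` on `Q(0, 1/2)`; so is the limit, a.e.
  set Q₀ : Set (ℝ × E³) := parabolicCylinder (1 / 2) (0 : ℝ × E³) with hQ₀
  have hQ₀meas : MeasurableSet Q₀ := by
    rw [hQ₀, parabolicCylinder]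
    exact (measurableSet_Ioo.prod measurableSet_ball)
  have hQ₀sub : Q₀ ⊆ Iio (0 : ℝ) ×ˢ (univ : Set E³) := parabolicCylinder_zero_subset_slab' _
  have himg_meas : ∀ k, AEStronglyMeasurable (uncurry (lk k • stPull (lk k ^ 2) (lk k) 0 (xk k) v))
      (volume.restrict Q₀) := fun k =>
    ((continuousOn_image hvc (hadm k).1 (xk k)).mono hQ₀sub).aestronglyMeasurable hQ₀meas
  have hw_meas : AEStronglyMeasurable (uncurry w) (volume.restrict Q₀) := by
    have hli : LocallyIntegrableOn (uncurry w) (Iio (0 : ℝ) ×ˢ (univ : Set E³)) volume := by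
      have := hw_sw.distributional.1
      rwa [coe_slab] at this
    exact (hli.aestronglyMeasurable).mono_measure (Measure.restrict_mono hQ₀sub le_rfl)
  -- pointwise bound of the images on `Q₀` (and a harmless bound elsewhere via the indicator trick:
  -- we bound the restricted functions by working with `Q₀.indicator`)
  have hbound : ∀ k, ∀ z ∈ Q₀, ‖uncurry (lk k • stPull (lk k ^ 2) (lk k) 0 (xk k) v) z‖ ≤ 2 * C := by
    intro k z hz
    rw [hQ₀, mem_parabolicCylinder] at hz
    obtain ⟨⟨-, hz2⟩, hz3⟩ := hz
    simp only [Prod.fst_zero, Prod.snd_zero, dist_zero_right] at hz2 hz3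
    exact norm_image_le_of_apex hdec_v (hadm k).1 (hadm k).2.1 (by simpa using hz2) (by
      have : ‖z.2‖ < 1 / 2 := by simpa using hz3
      exact this.le)
  -- pass to indicators so that the bound holds everywhere
  have hconv' : Tendsto (fun k => eLpNorm
      (Q₀.indicator (uncurry (lk k • stPull (lk k ^ 2) (lk k) 0 (xk k) v)) - Q₀.indicator (uncurry w))
      3 (volume.restrict Q₀)) atTop (𝓝 0) := by
    refine (hconv (1 / 2) (by norm_num)).congr fun k => ?_
    refine eLpNorm_congr_ae ?_
    filter_upwards [ae_restrict_mem hQ₀meas] with z hz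
    have hz' : z ∈ Q₀ := hz
    rw [Pi.sub_apply, Pi.sub_apply, indicator_of_mem hz', indicator_of_mem hz']
  have hae_le : ∀ᵐ z ∂(volume.restrict Q₀), ‖Q₀.indicator (uncurry w) z‖ ≤ 2 * C := by
    refine ae_norm_le_of_tendsto_eLpNorm_three (fun k => (himg_meas k).indicator hQ₀meas)
      (hw_meas.indicator hQ₀meas) (fun k z => ?_) hconv'
    by_cases hz : z ∈ Q₀
    · rw [indicator_of_mem hz]
      exact hbound k z hz
    · rw [indicator_of_notMem hz, norm_zero]
      positivity
  have hae_le' : ∀ᵐ z ∂(volume.restrict Q₀), ‖uncurry w z‖ₑ ≤ ENNReal.ofReal (2 * C) := by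
    filter_upwards [hae_le, ae_restrict_mem hQ₀meas] with z hz hzQ
    rw [indicator_of_mem hzQ] at hz
    rw [← ofReal_norm]
    exact ENNReal.ofReal_le_ofReal hz
  have hfin : eLpNorm (uncurry w) ∞ (volume.restrict Q₀) ≤ ENNReal.ofReal (2 * C) := by
    rw [eLpNorm_exponent_top]
    exact eLpNormEssSup_le_of_ae_enorm_bound hae_le'
  have htop := hwsing (1 / 2) (by norm_num)
  rw [← hQ₀] at htop
  rw [htop] at hfin
  exact absurd hfin (not_le.2 ENNReal.ofReal_lt_top)

/-- **Crux ⇒ bet.** `RellichScar.ApexLocalisation` implies the conclusion of the registered bet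
`stub_sparseSelection` for every `C` (so, together with the skeleton's composition, the bet is
EXACTLY as strong as the crux once the four known stubs are in): localise the given rate profile by
the crux and apply `sparse_of_apexProfile` to the apex profile. -/
theorem sparseSelection_of_apexLocalisation (hcrux : RellichScar.ApexLocalisation) (C : ℝ)
    (hant : ∃ (u : ℝ → E³ → E³) (p : ℝ → E³ → ℝ) (G : ℝ → E³ → E³ →L[ℝ] E³),
      IsSuitableWeakSolutionOn (slab E³ (Iio 0) isOpen_Iio) 1 0 u p ∧
      HasWeakSpatialGradientOn (slab E³ (Iio 0) isOpen_Iio) u G ∧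
      typeIBound (Iio (0 : ℝ) ×ˢ univ) u p G < ⊤ ∧
      HasTypeITimeDecay C u ∧ IsBackwardSingularPoint u 0) :
    ∃ (C' : ℝ) (I' : ℝ≥0∞) (u : ℝ → E³ → E³) (p : ℝ → E³ → ℝ) (G : ℝ → E³ → E³ →L[ℝ] E³),
      I' < ⊤ ∧
      IsSuitableWeakSolutionOn (slab E³ (Iio 0) isOpen_Iio) 1 0 u p ∧
      HasWeakSpatialGradientOn (slab E³ (Iio 0) isOpen_Iio) u G ∧
      typeIBound (Iio (0 : ℝ) ×ˢ univ) u p G ≤ I' ∧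
      HasTypeITimeDecay C' u ∧
      ContinuousOn (uncurry u) (Iio (0 : ℝ) ×ˢ univ) ∧
      IsBackwardSingularPoint u 0 ∧
      ∀ (lk : ℕ → ℝ) (xk : ℕ → E³) (v : ℝ → E³ → E³) (q : ℝ → E³ → ℝ)
        (H : ℝ → E³ → E³ →L[ℝ] E³),
        (∀ k, 0 < lk k ∧ lk k ≤ ‖xk k‖ ∧ ‖xk k‖ ≤ 2 * lk k) →
        IsSuitableWeakSolutionOn (slab E³ (Iio 0) isOpen_Iio) 1 0 v q →
        HasWeakSpatialGradientOn (slab E³ (Iio 0) isOpen_Iio) v H →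
        typeIBound (Iio (0 : ℝ) ×ˢ univ) v q H ≤ 4 * I' →
        HasTypeITimeDecay C' v →
        ContinuousOn (uncurry v) (Iio (0 : ℝ) ×ˢ univ) →
        (∀ R : ℝ, 0 < R → Tendsto (fun k => eLpNorm
          (uncurry (lk k • stPull (lk k ^ 2) (lk k) 0 (xk k) u) - uncurry v) 3
          (volume.restrict (parabolicCylinder R (0 : ℝ × E³)))) atTop (𝓝 0)) →
        ¬ IsBackwardSingularPoint v 0 := by
  obtain ⟨C₁, u, p, G, hsw, hwg, hI, hdec, hsing⟩ := hcrux C hant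
  exact sparse_of_apexProfile (C := C₁) hsw hwg hI hdec hsing

end Summit.NavierStokesRegularity.NavierStokesRegularity.Theorems.RellichScarApexLocalisation
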